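import Literature.Geometry.Lorentzian.HawkingCrushBoundHolds
import HarnessLib

/-!
# Crux `TameCensorship` (stmt-FinalStateConjecture-10047), line `crush-the-swallowed-interior`:
# fact-stub FH `stub_factHawkingCrushBound` — discharged from the tree

The registered fact-stub `stub_factHawkingCrushBound : HawkingCrushBound.{0}` of the skeleton
`Cruxes/TameCensorship/Lines/crush_the_swallowed_interior.lean` (lead c1) is the Literature named
fact `Literature.Geometry.Lorentzian.HawkingCrushBound` (Wald 1984, Thm. 9.5.1, time reversed:
in a globally hyperbolic four-dimensional spacetime with the timelike convergence condition, a
smooth spacelike Cauchy hypersurface with mean curvature `H ≤ -C < 0` has every event within time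
separation `3/C` of it), at universe `0`. Its discharge
`Literature.Geometry.Lorentzian.HawkingCrushBound_holds` (`HawkingCrushBoundHolds.lean`: O'Neill's
maximising normal geodesic, Thm. 14.44, and the second variation, Prop. 10.37) landed in the tree
on 2026-08-16; this file records the stub as its instance, so that the line's composition
`namedFacts` / `TameCensorship_of` can import it. Together with
`stub_factFutureCauchyCrushBound` (`…TameCensorshipFutureCauchyCrushBound.lean`) this closes the
Hawking-bound inputs (F1, FH) of `stub_crush`.

## References

* R. M. Wald, *General Relativity*, Chicago 1984, Thm. 9.5.1 (p. 237). [Wald1984GR]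
* B. O'Neill, *Semi-Riemannian geometry with applications to relativity*, Academic Press 1983,
  Ch. 14, Thm. 14.44, Thm. 14.55A (pp. 427–432). [ONeillSemiRiemannian1983]
-/

noncomputable section

-- The tree namespace `Summit.FinalStateConjecture.FinalStateConjecture.…` (summit = sub-problem)
-- repeats a component by design (D-0022), which the `dupNamespace` linter would flag on every decl.
set_option linter.dupNamespace false

open Literature.Geometry.Lorentzian

namespace Summit.FinalStateConjecture.FinalStateConjecture.Theorems.PhotonSphereChannels.TameCensorshipCrush

/-- **FACT-STUB FH — Hawking's crush bound, Wald's Cauchy form** (the registered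
`stub_factHawkingCrushBound` of the line `crush-the-swallowed-interior`, crux `TameCensorship`):
`HawkingCrushBound` at universe `0`, by the tree's discharge `HawkingCrushBound_holds`.
[cite: Wald1984GR, Theorem 9.5.1 (p. 237)] [cite: ONeillSemiRiemannian1983, Ch. 14, Thm. 14.55A (pp. 431–432)] -/
theorem stub_factHawkingCrushBound : HawkingCrushBound.{0} :=
  HawkingCrushBound_holds

end Summit.FinalStateConjecture.FinalStateConjecture.Theorems.PhotonSphereChannels.TameCensorshipCrush

end
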